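import Mathlib.Analysis.Calculus.IteratedDeriv.Lemmas
import Mathlib.Analysis.Calculus.Deriv.Shift
import Mathlib.Analysis.SpecialFunctions.ExpDeriv
import Mathlib.Analysis.SpecialFunctions.Trigonometric.Bounds
import Mathlib.Topology.Algebra.Support
import Literature.Analysis.Fourier.MatsubaraSummationByParts
import Literature.Analysis.Calculus.IteratedDifferenceDerivBound
import HarnessLib

/-!
# Exponential sums with a smooth coefficient profile: derivative and tail bounds

Topic `Literature/Analysis/Fourier`.  For a coefficient PROFILE `b : ℝ → ℂ` and a mesh `1/t` we study
the trigonometric polynomial `V_{b,t}(θ) = Σ_{ν=0}^{t} b(ν/t) e^{iνθ}` and its `θ`-derivatives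
`V^{(r)}_{b,t}(θ) = Σ_{ν=0}^{t} b(ν/t) (iν)^r e^{iνθ}` (`profSum b t r θ`).  The two estimates of the
file are the ones behind Bauerschmidt's finite-range polynomials `W_t` ("`φ_t` is essentially supported
in `|x| ≲ 1/t` with all derivatives, because `φ̂` is smooth", [Bauerschmidt2013, Lemma 2.3 and (2.10)];
Buchholz 2018, Lemma 5.1) in a purely DISCRETE form that avoids Poisson summation:

* `norm_profSum_le` — the trivial bound `‖V^{(r)}_{b,t}(θ)‖ ≤ t^r Σ_ν ‖b(ν/t)‖`, and
  `norm_profSum_le_of_bound` — `≤ K (t+1) t^r` if `‖b‖ ≤ K`;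
* **`exists_norm_profSum_le_tail`** — if `b` is smooth and vanishes off `[0,1]` then for all `r, j`
  there is `C` with `‖V^{(r)}_{b,t}(θ)‖ ≤ C t^{r+1} (t|θ|)^{-j}` for `t ≥ 1`, `0 < |θ| ≤ π`:
  `j` summations by parts (`pow_mul_norm_sum_phase_le` of `MatsubaraSummationByParts.lean`) followed by
  the `j`-fold mean value theorem for the sampled profile (`norm_fwdDiff_iter_le_of_norm_iteratedDeriv_le`
  of `IteratedDifferenceDerivBound.lean`): `‖∇^j [b(·/t)(i·)^r]‖ ≤ t^{r-j} sup‖((iξ)^r b)^{(j)}‖`.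
* `hasDerivAt_profSum`, `iteratedDeriv_profSum` — `(d/dθ)^k V^{(r)} = V^{(r+k)}`; `contDiff_profSum`.

Everything is proved; no named facts.  These sums are the building block of the smooth-profile
Chebyshev low-pass polynomials used for the finite-range decomposition with `A`-regularity of all
orders (Buchholz, J. Funct. Anal. 275 (2018), Thm 2.4; see
`Literature/MathematicalPhysics/StatisticalMechanics/TorusFiniteRangeDecomposition.lean`).

## References
* R. Bauerschmidt, *A simple method for finite range decomposition of quadratic forms and Gaussian
  fields*, Probab. Theory Relat. Fields 157 (2013), Lemma 2.3 [Bauerschmidt2013].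
* S. Buchholz, *Finite range decomposition for Gaussian measures with improved regularity*,
  J. Funct. Anal. 275 (2018), Lemma 5.1 [Buchholz2016].
-/

noncomputable section

open Finset Complex
open scoped Real

namespace Literature.Analysis.Fourier

/-! ## The profile sums -/

/-- The weighted exponential sum `V^{(r)}_{b,t}(θ) = Σ_{ν=0}^{t} b(ν/t) (iν)^r e^{iνθ}` — the `r`-th
`θ`-derivative of the trigonometric polynomial `Σ_{ν=0}^t b(ν/t) e^{iνθ}` whose coefficients SAMPLE the
profile `b` at mesh `1/t` (Bauerschmidt's `W_t` has coefficients `φ̂(ν/t)`). [cite: Bauerschmidt2013, Lemma 2.3] -/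
def profSum (b : ℝ → ℂ) (t r : ℕ) (θ : ℝ) : ℂ :=
  ∑ ν ∈ Icc (0 : ℤ) t, b ((ν : ℝ) / t) * (I * (ν : ℂ)) ^ r * cexp (I * (ν : ℂ) * (θ : ℂ))

/-- The derivative of one mode: `d/dθ e^{iνθ} = iν e^{iνθ}`. [folklore] -/
private theorem hasDerivAt_cexp_mode (ν : ℤ) (θ : ℝ) :
    HasDerivAt (fun θ : ℝ => cexp (I * (ν : ℂ) * (θ : ℂ))) (I * (ν : ℂ) * cexp (I * (ν : ℂ) * (θ : ℂ))) θ := by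
  have h1 : HasDerivAt (fun θ : ℝ => I * (ν : ℂ) * (θ : ℂ)) (I * (ν : ℂ) * 1) θ :=
    (hasDerivAt_id θ).ofReal_comp.const_mul (I * (ν : ℂ))
  exact h1.cexp.congr_deriv (by ring)

/-- `d/dθ V^{(r)}_{b,t} = V^{(r+1)}_{b,t}` (the polynomials `W_t` are differentiated termwise).
[cite: Bauerschmidt2013, Lemma 2.3 (proof)] -/
theorem hasDerivAt_profSum (b : ℝ → ℂ) (t r : ℕ) (θ : ℝ) :
    HasDerivAt (profSum b t r) (profSum b t (r + 1) θ) θ := by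
  unfold profSum
  exact HasDerivAt.fun_sum (u := Finset.Icc (0 : ℤ) t)
    (A := fun ν (θ : ℝ) => b ((ν : ℝ) / t) * (I * (ν : ℂ)) ^ r * cexp (I * (ν : ℂ) * (θ : ℂ)))
    (A' := fun ν => b ((ν : ℝ) / t) * (I * (ν : ℂ)) ^ (r + 1) * cexp (I * (ν : ℂ) * (θ : ℂ)))
    (x := θ) fun ν _ => ((hasDerivAt_cexp_mode ν θ).const_mul _).congr_deriv (by ring)

/-- `deriv V^{(r)}_{b,t} = V^{(r+1)}_{b,t}`. [cite: Bauerschmidt2013, Lemma 2.3 (proof)] -/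
theorem deriv_profSum (b : ℝ → ℂ) (t r : ℕ) : deriv (profSum b t r) = profSum b t (r + 1) :=
  funext fun θ => (hasDerivAt_profSum b t r θ).deriv

/-- `(d/dθ)^k V^{(r)}_{b,t} = V^{(r+k)}_{b,t}`. [cite: Bauerschmidt2013, Lemma 2.3 (proof)] -/
theorem iteratedDeriv_profSum (b : ℝ → ℂ) (t : ℕ) :
    ∀ (k r : ℕ), iteratedDeriv k (profSum b t r) = profSum b t (r + k)
  | 0, r => by rw [iteratedDeriv_zero, add_zero]
  | k + 1, r => by
    rw [iteratedDeriv_succ', deriv_profSum, iteratedDeriv_profSum b t k (r + 1), add_assoc,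
      add_comm 1 k]

/-- `V^{(r)}_{b,t}` is differentiable. [cite: Bauerschmidt2013, Lemma 2.3 (proof)] -/
theorem differentiable_profSum (b : ℝ → ℂ) (t r : ℕ) : Differentiable ℝ (profSum b t r) :=
  fun θ => (hasDerivAt_profSum b t r θ).differentiableAt

/-- `V^{(r)}_{b,t}` is smooth (indeed analytic: a finite sum of exponentials) — "`W_t ∈ C^∞`".
[cite: Bauerschmidt2013, Lemma 2.3 (proof)] -/
theorem contDiff_profSum (b : ℝ → ℂ) (t r : ℕ) {n : WithTop ℕ∞} : ContDiff ℝ n (profSum b t r) := by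
  unfold profSum
  refine ContDiff.sum fun ν _ => ?_
  exact contDiff_const.mul (Complex.contDiff_exp.comp (contDiff_const.mul Complex.ofRealCLM.contDiff))

/-! ## The trivial bound -/

/-- `‖(iν)^r e^{iνθ}‖ ≤ t^r` for `0 ≤ ν ≤ t`. [folklore] -/
private theorem norm_mode_weight_le {t r : ℕ} {ν : ℤ} (hν : ν ∈ Finset.Icc (0 : ℤ) t) (θ : ℝ) :
    ‖(I * (ν : ℂ)) ^ r * cexp (I * (ν : ℂ) * (θ : ℂ))‖ ≤ (t : ℝ) ^ r := by
  rw [Finset.mem_Icc] at hν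
  have hexp : ‖cexp (I * (ν : ℂ) * (θ : ℂ))‖ = 1 := by
    rw [show I * (ν : ℂ) * (θ : ℂ) = (((ν : ℝ) * θ : ℝ) : ℂ) * I by push_cast; ring,
      Complex.norm_exp_ofReal_mul_I]
  rw [norm_mul, hexp, mul_one, norm_pow, norm_mul, Complex.norm_I, one_mul, Complex.norm_intCast]
  have h0 : (0 : ℝ) ≤ (ν : ℝ) := by exact_mod_cast hν.1
  have h1 : ((ν : ℤ) : ℝ) ≤ (t : ℝ) := by exact_mod_cast hν.2
  rw [abs_of_nonneg h0]
  exact pow_le_pow_left₀ h0 h1 r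

/-- **Trivial bound** `‖V^{(r)}_{b,t}(θ)‖ ≤ t^r Σ_{ν=0}^t ‖b(ν/t)‖` (the case `n = 0` of the symbol
estimate `(1+t²λ)^n λ^ℓ |∂^ℓ W_t| ≤ C_{ℓ,n}`). [cite: Buchholz2016, Lemma 5.1 (5.3), n = 0] -/
theorem norm_profSum_le (b : ℝ → ℂ) (t r : ℕ) (θ : ℝ) :
    ‖profSum b t r θ‖ ≤ (t : ℝ) ^ r * ∑ ν ∈ Finset.Icc (0 : ℤ) t, ‖b ((ν : ℝ) / t)‖ := by
  unfold profSum
  rw [mul_sum]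
  refine (norm_sum_le _ _).trans (sum_le_sum fun ν hν => ?_)
  rw [mul_assoc, norm_mul]
  calc ‖b ((ν : ℝ) / t)‖ * ‖(I * (ν : ℂ)) ^ r * cexp (I * (ν : ℂ) * (θ : ℂ))‖
      ≤ ‖b ((ν : ℝ) / t)‖ * (t : ℝ) ^ r :=
        mul_le_mul_of_nonneg_left (norm_mode_weight_le hν θ) (norm_nonneg _)
    _ = (t : ℝ) ^ r * ‖b ((ν : ℝ) / t)‖ := mul_comm _ _

/-- The number of sample points: `#Icc 0 t = t + 1`. [folklore] -/
private theorem card_Icc_zero_natCast (t : ℕ) : (Finset.Icc (0 : ℤ) t).card = t + 1 := by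
  rw [Int.card_Icc]; omega

/-- `‖V^{(r)}_{b,t}(θ)‖ ≤ K (t+1) t^r` whenever `‖b‖ ≤ K` pointwise (symbol estimate, `n = 0`).
[cite: Buchholz2016, Lemma 5.1 (5.3), n = 0] -/
theorem norm_profSum_le_of_bound {b : ℝ → ℂ} {K : ℝ} (hK : ∀ x, ‖b x‖ ≤ K) (t r : ℕ) (θ : ℝ) :
    ‖profSum b t r θ‖ ≤ K * (t + 1) * (t : ℝ) ^ r := by
  refine (norm_profSum_le b t r θ).trans ?_
  have hs : ∑ ν ∈ Finset.Icc (0 : ℤ) t, ‖b ((ν : ℝ) / t)‖ ≤ K * (t + 1) := by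
    refine (sum_le_sum fun ν _ => hK _).trans (le_of_eq ?_)
    rw [sum_const, card_Icc_zero_natCast, nsmul_eq_mul]
    push_cast
    ring
  calc (t : ℝ) ^ r * ∑ ν ∈ Finset.Icc (0 : ℤ) t, ‖b ((ν : ℝ) / t)‖ ≤ (t : ℝ) ^ r * (K * (t + 1)) :=
        mul_le_mul_of_nonneg_left hs (by positivity)
    _ = K * (t + 1) * (t : ℝ) ^ r := by ring

/-! ## Summation by parts: the tail bound -/

/-- Iterated BACKWARD differences of a sequence sampled from `φ : ℝ → E` at the integers are iterated
FORWARD differences (step `1`) of the reflected function `y ↦ φ(-y)`, evaluated at `-ν`. [folklore] -/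
private theorem fwdDiff_iter_neg_one_intCast_eq {E : Type*} [AddCommGroup E] (φ : ℝ → E) (N : ℕ) (ν : ℤ) :
    ((fwdDiff (-1 : ℤ))^[N] fun μ : ℤ => φ μ) ν = ((fwdDiff (1 : ℝ))^[N] fun y : ℝ => φ (-y)) (-(ν : ℝ)) := by
  rw [fwdDiff_iter_eq_sum_shift, fwdDiff_iter_eq_sum_shift]
  refine sum_congr rfl fun k _ => ?_
  have h : (((ν + k • (-1 : ℤ) : ℤ)) : ℝ) = -(-(ν : ℝ) + k • (1 : ℝ)) := by
    simp only [mul_neg, mul_one, Int.cast_add, Int.cast_neg, Int.cast_natCast, nsmul_eq_mul]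
    ring
  simp only [h]

/-- A smooth function vanishing off a compact set has bounded iterated derivatives: if `β` is `C^j` and
`β = 0` off `[0,1]` then `sup ‖β^{(j)}‖ < ∞` (its `j`-th derivative is continuous and vanishes off `[0,1]`).
[folklore] -/
private theorem exists_bound_iteratedDeriv_of_eq_zero_off_Icc {β : ℝ → ℂ} {j : ℕ} (hβ : ContDiff ℝ j β)
    (hβ0 : ∀ x, x ∉ Set.Icc (0 : ℝ) 1 → β x = 0) : ∃ K, 0 ≤ K ∧ ∀ y, ‖iteratedDeriv j β y‖ ≤ K := by
  have hcont : Continuous (iteratedDeriv j β) := hβ.continuous_iteratedDeriv j le_rfl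
  have hsupp : HasCompactSupport (iteratedDeriv j β) := by
    refine HasCompactSupport.intro (K := Set.Icc (0 : ℝ) 1) isCompact_Icc fun x hx => ?_
    have hev : β =ᶠ[nhds x] (fun _ => (0 : ℂ)) := by
      have hopen : IsOpen ((Set.Icc (0 : ℝ) 1)ᶜ) := isClosed_Icc.isOpen_compl
      filter_upwards [hopen.mem_nhds hx] with y hy using hβ0 y hy
    rw [hev.iteratedDeriv_eq j, iteratedDeriv_const]
    split_ifs <;> rfl
  obtain ⟨C, hC⟩ := hsupp.exists_bound_of_continuous hcont
  exact ⟨max C 0, le_max_right _ _, fun y => (hC y).trans (le_max_left _ _)⟩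

/-- `2|sin(θ/2)| ≥ 2|θ|/π` for `|θ| ≤ π` (Jordan's inequality). [folklore] -/
private theorem two_mul_abs_theta_div_pi_le (θ : ℝ) (hθ : |θ| ≤ π) : 2 * |θ| / π ≤ 2 * |Real.sin (θ / 2)| := by
  have hπ := Real.pi_pos
  obtain ⟨hl, hu⟩ := abs_le.1 hθ
  have h1 : 2 / π * (|θ| / 2) ≤ Real.sin (|θ| / 2) :=
    Real.mul_le_sin (by positivity) (by linarith)
  have h2 : Real.sin (|θ| / 2) = |Real.sin (θ / 2)| := by
    rcases le_or_gt 0 θ with h | h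
    · rw [abs_of_nonneg h, abs_of_nonneg]
      exact Real.sin_nonneg_of_nonneg_of_le_pi (by linarith) (by linarith)
    · rw [abs_of_neg h, neg_div, Real.sin_neg, abs_of_nonpos]
      exact Real.sin_nonpos_of_nonpos_of_neg_pi_le (by linarith) (by linarith)
  calc 2 * |θ| / π = 2 * (2 / π * (|θ| / 2)) := by ring
    _ ≤ 2 * Real.sin (|θ| / 2) := by linarith
    _ = 2 * |Real.sin (θ / 2)| := by rw [h2]

/-- **Tail bound for smooth-profile exponential sums** (discrete form of [Bauerschmidt2013, Lemma 2.3,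
(2.10)]: the polynomial with coefficients `φ̂(ν/t)` is concentrated on `|θ| ≲ 1/t` together with all its
derivatives).  If `b` is smooth and vanishes off `[0,1]`, then for all `r, j` there is `C` such that
`‖Σ_{ν=0}^t b(ν/t)(iν)^r e^{iνθ}‖ ≤ C t^{r+1} (t|θ|)^{-j}` for all `t ≥ 1` and `0 < |θ| ≤ π`.
Proof: `j` summations by parts and the `j`-fold mean value theorem for `ξ ↦ (iξ)^r b(ξ)` sampled at
mesh `1/t`. [cite: Buchholz2016, Lemma 5.1 (5.3)] -/
theorem exists_norm_profSum_le_tail {b : ℝ → ℂ} (hb : ∀ n : ℕ, ContDiff ℝ n b)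
    (hb0 : ∀ x, x ∉ Set.Icc (0 : ℝ) 1 → b x = 0) (r j : ℕ) :
    ∃ C, 0 ≤ C ∧ ∀ t : ℕ, 1 ≤ t → ∀ θ : ℝ, θ ≠ 0 → |θ| ≤ π →
      ‖profSum b t r θ‖ ≤ C * (t : ℝ) ^ (r + 1) / ((t : ℝ) * |θ|) ^ j := by
  -- the profile `β(ξ) = (iξ)^r b(ξ)` and a bound `K` for its `j`-th derivative
  set β : ℝ → ℂ := fun ξ => (I * (ξ : ℂ)) ^ r * b ξ with hβdef
  have hβ : ∀ n : ℕ, ContDiff ℝ n β := fun n =>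
    ((contDiff_const.mul Complex.ofRealCLM.contDiff).pow r).mul (hb n)
  have hβ0 : ∀ x, x ∉ Set.Icc (0 : ℝ) 1 → β x = 0 := fun x hx => by
    simp only [hβdef, hb0 x hx, mul_zero]
  obtain ⟨K, hK0, hK⟩ := exists_bound_iteratedDeriv_of_eq_zero_off_Icc (hβ j) hβ0
  refine ⟨(π / 2) ^ j * (j + 2) * K, by positivity, fun t ht θ hθ0 hθπ => ?_⟩
  have htpos : (0 : ℝ) < t := by exact_mod_cast ht
  have hθpos : 0 < |θ| := abs_pos.2 hθ0
  -- the sampled sequence on `ℤ`, vanishing off `Icc 0 t`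
  set φG : ℝ → ℂ := fun y => (t : ℂ) ^ r * β (y / t) with hφGdef
  set G : ℤ → ℂ := fun μ => φG μ with hGdef
  have hG : ∀ ν, ν ∉ Finset.Icc (0 : ℤ) t → G ν = 0 := by
    intro ν hν
    have hν' : ((ν : ℝ) / t) ∉ Set.Icc (0 : ℝ) 1 := by
      rw [Finset.mem_Icc] at hν
      rw [Set.mem_Icc]
      rw [le_div_iff₀ htpos, div_le_iff₀ htpos, zero_mul, one_mul]
      exact_mod_cast hν
    simp only [hGdef, hφGdef, hβ0 _ hν', mul_zero]
  -- `profSum` is the phase sum of `MatsubaraSummationByParts` with `a = 0`, `δ = -1`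
  have hsum : profSum b t r θ =
      ∑ ν ∈ Finset.Icc (0 : ℤ) t, cexp (-(I * (((0 + (-1) * (ν : ℝ)) * θ : ℝ) : ℂ))) • G ν := by
    unfold profSum
    refine sum_congr rfl fun ν _ => ?_
    have ht0 : (t : ℂ) ≠ 0 := by exact_mod_cast htpos.ne'
    rw [smul_eq_mul, hGdef, hφGdef, hβdef]
    simp only
    rw [show cexp (-(I * (((0 + (-1) * (ν : ℝ)) * θ : ℝ) : ℂ))) = cexp (I * (ν : ℂ) * (θ : ℂ)) by
      congr 1; push_cast; ring]
    rw [show (((ν : ℝ) / t : ℝ) : ℂ) = (ν : ℂ) / (t : ℂ) by push_cast; rfl, mul_pow, mul_pow, div_pow]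
    field_simp
  -- summation by parts, `j` times
  have hparts := pow_mul_norm_sum_phase_le j G hG 0 (-1) θ
  rw [← hsum, show (-1 : ℝ) * θ / 2 = -(θ / 2) by ring, Real.sin_neg, abs_neg] at hparts
  -- each `j`-th difference is bounded by `t^r t^{-j} K`
  set ψ : ℝ → ℂ := fun y => (t : ℂ) ^ r * β (-(t : ℝ)⁻¹ * y) with hψdef
  have hinner : ContDiff ℝ j (fun y : ℝ => β (-(t : ℝ)⁻¹ * y)) := (hβ j).comp (contDiff_const.mul contDiff_id)
  have hψcd : ContDiff ℝ j ψ := contDiff_const.mul hinner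
  have hψderiv : ∀ y, ‖iteratedDeriv j ψ y‖ ≤ (t : ℝ) ^ r * ((t : ℝ)⁻¹) ^ j * K := by
    intro y
    rw [hψdef, iteratedDeriv_const_mul ((t : ℂ) ^ r) hinner.contDiffAt,
      iteratedDeriv_comp_const_smul (hβ j) (-(t : ℝ)⁻¹), norm_mul, norm_smul, norm_pow, norm_pow,
      Complex.norm_natCast, norm_neg, norm_inv, Real.norm_natCast, mul_assoc]
    exact mul_le_mul_of_nonneg_left (mul_le_mul_of_nonneg_left (hK _) (by positivity)) (by positivity)
  have hdiff : ∀ ν ∈ Finset.Icc (0 : ℤ) (t + j), ‖((fwdDiff (-1 : ℤ))^[j] G) ν‖ ≤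
      (t : ℝ) ^ r * ((t : ℝ)⁻¹) ^ j * K := by
    intro ν _
    rw [hGdef, fwdDiff_iter_neg_one_intCast_eq φG j ν]
    have hre : (fun y : ℝ => φG (-y)) = ψ := by
      funext y; simp only [hψdef, hφGdef]; congr 1; ring
    rw [hre]
    have h := Literature.Analysis.Calculus.norm_fwdDiff_iter_le_of_norm_iteratedDeriv_le j ψ hψcd
      zero_le_one (-(ν : ℝ)) (K := (t : ℝ) ^ r * ((t : ℝ)⁻¹) ^ j * K) (fun s _ => hψderiv s)
    simpa using h
  -- sum of the differences
  have hrhs : ∑ ν ∈ Finset.Icc (0 : ℤ) (t + j), ‖((fwdDiff (-1 : ℤ))^[j] G) ν‖ ≤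
      (t + j + 1) * ((t : ℝ) ^ r * ((t : ℝ)⁻¹) ^ j * K) := by
    refine (sum_le_sum hdiff).trans (le_of_eq ?_)
    rw [sum_const, nsmul_eq_mul, show ((t : ℤ) + j : ℤ) = ((t + j : ℕ) : ℤ) by push_cast; rfl,
      card_Icc_zero_natCast]
    push_cast
    ring
  -- Jordan: `(2|θ|/π)^j ≤ (2|sin(θ/2)|)^j`
  have hsin : (2 * |θ| / π) ^ j ≤ (2 * |Real.sin (θ / 2)|) ^ j :=
    pow_le_pow_left₀ (by positivity) (two_mul_abs_theta_div_pi_le θ hθπ) j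
  have hjor : 0 < (2 * |θ| / π) ^ j := by positivity
  have hmain : (2 * |θ| / π) ^ j * ‖profSum b t r θ‖ ≤ (t + j + 1) * ((t : ℝ) ^ r * ((t : ℝ)⁻¹) ^ j * K) :=
    ((mul_le_mul_of_nonneg_right hsin (norm_nonneg _)).trans hparts).trans hrhs
  have htj : (t : ℝ) + j + 1 ≤ (j + 2) * t := by
    have : (1 : ℝ) ≤ t := by exact_mod_cast ht
    nlinarith
  have key : ‖profSum b t r θ‖ * |θ| ^ j ≤ (π / 2) ^ j * K * ((t : ℝ) + j + 1) * (t : ℝ) ^ r * ((t : ℝ)⁻¹) ^ j := by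
    have hid : (π / 2) ^ j * (2 * |θ| / π) ^ j = |θ| ^ j := by
      rw [← mul_pow]; congr 1; field_simp
    calc ‖profSum b t r θ‖ * |θ| ^ j = (π / 2) ^ j * ((2 * |θ| / π) ^ j * ‖profSum b t r θ‖) := by
          rw [← mul_assoc, hid, mul_comm]
      _ ≤ (π / 2) ^ j * ((t + j + 1) * ((t : ℝ) ^ r * ((t : ℝ)⁻¹) ^ j * K)) :=
          mul_le_mul_of_nonneg_left hmain (by positivity)
      _ = (π / 2) ^ j * K * ((t : ℝ) + j + 1) * (t : ℝ) ^ r * ((t : ℝ)⁻¹) ^ j := by ring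
  rw [le_div_iff₀ (by positivity), mul_pow,
    show ‖profSum b t r θ‖ * ((t : ℝ) ^ j * |θ| ^ j) = (‖profSum b t r θ‖ * |θ| ^ j) * (t : ℝ) ^ j by ring]
  calc (‖profSum b t r θ‖ * |θ| ^ j) * (t : ℝ) ^ j
      ≤ ((π / 2) ^ j * K * ((t : ℝ) + j + 1) * (t : ℝ) ^ r * ((t : ℝ)⁻¹) ^ j) * (t : ℝ) ^ j :=
        mul_le_mul_of_nonneg_right key (by positivity)
    _ = (π / 2) ^ j * K * ((t : ℝ) + j + 1) * (t : ℝ) ^ r * (((t : ℝ)⁻¹ * t) ^ j) := by rw [mul_pow]; ring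
    _ = (π / 2) ^ j * K * ((t : ℝ) + j + 1) * (t : ℝ) ^ r := by
        rw [inv_mul_cancel₀ htpos.ne', one_pow, mul_one]
    _ ≤ (π / 2) ^ j * K * ((j + 2) * (t : ℝ)) * (t : ℝ) ^ r := by gcongr
    _ = (π / 2) ^ j * (j + 2) * K * (t : ℝ) ^ (r + 1) := by ring

/-- The tail bound in `min` form: `‖V^{(r)}_{b,t}(θ)‖ ≤ C t^{r+1} min(1, (t|θ|)^{-j})` for `t ≥ 1`,
`0 < |θ| ≤ π` (symbol estimate `(1 + t²λ)^n λ^ℓ|∂^ℓ W_t| ≤ C_{ℓ,n}` in the angle variable).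
[cite: Buchholz2016, Lemma 5.1 (5.3)] -/
theorem exists_norm_profSum_le_min {b : ℝ → ℂ} (hb : ∀ n : ℕ, ContDiff ℝ n b)
    (hb0 : ∀ x, x ∉ Set.Icc (0 : ℝ) 1 → b x = 0) (r j : ℕ) :
    ∃ C, 0 ≤ C ∧ ∀ t : ℕ, 1 ≤ t → ∀ θ : ℝ, θ ≠ 0 → |θ| ≤ π →
      ‖profSum b t r θ‖ ≤ C * (t : ℝ) ^ (r + 1) * min 1 (1 / ((t : ℝ) * |θ|) ^ j) := by
  obtain ⟨C₁, hC₁, h₁⟩ := exists_norm_profSum_le_tail hb hb0 r j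
  obtain ⟨K, hK0, hK⟩ := exists_bound_iteratedDeriv_of_eq_zero_off_Icc (hb 0) hb0
  refine ⟨max C₁ (2 * K), le_max_of_le_left hC₁, fun t ht θ hθ0 hθπ => ?_⟩
  have htpos : (0 : ℝ) < t := by exact_mod_cast ht
  rcases le_total 1 (1 / ((t : ℝ) * |θ|) ^ j) with h | h
  · rw [min_eq_left h]
    have hK' : ∀ x, ‖b x‖ ≤ K := fun x => by simpa using hK x
    calc ‖profSum b t r θ‖ ≤ K * (t + 1) * (t : ℝ) ^ r := norm_profSum_le_of_bound hK' t r θ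
      _ ≤ K * (2 * t) * (t : ℝ) ^ r := by
          have h1t : (1 : ℝ) ≤ t := by exact_mod_cast ht
          have h2t : (t : ℝ) + 1 ≤ 2 * t := by linarith
          have h1 : 0 ≤ (t : ℝ) ^ r := by positivity
          nlinarith [mul_nonneg hK0 h1]
      _ = 2 * K * (t : ℝ) ^ (r + 1) := by ring
      _ ≤ max C₁ (2 * K) * (t : ℝ) ^ (r + 1) * 1 := by
          rw [mul_one]; exact mul_le_mul_of_nonneg_right (le_max_right _ _) (by positivity)
  · rw [min_eq_right h]
    calc ‖profSum b t r θ‖ ≤ C₁ * (t : ℝ) ^ (r + 1) / ((t : ℝ) * |θ|) ^ j := h₁ t ht θ hθ0 hθπ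
      _ = C₁ * (t : ℝ) ^ (r + 1) * (1 / ((t : ℝ) * |θ|) ^ j) := by ring
      _ ≤ max C₁ (2 * K) * (t : ℝ) ^ (r + 1) * (1 / ((t : ℝ) * |θ|) ^ j) :=
          mul_le_mul_of_nonneg_right (mul_le_mul_of_nonneg_right (le_max_left _ _) (by positivity))
            (by positivity)

end Literature.Analysis.Fourier

end
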